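import Mathlib.Algebra.Homology.ConcreteCategory
import Literature.AlgebraicTopology.SingularHomology.CapProduct
import Literature.AlgebraicTopology.SingularHomology.RelativeHomology
import Literature.AlgebraicTopology.SingularHomology.LocalHomology
import HarnessLib

/-!
# The relative cap product `Hᵖ(X; R) × Hₙ(X, A; M) → H_q(X, A; M)` and its boundary formula
(trunk G04 AlgTop)

For a pair `(X, A)` (`A : Set X`), a commutative ring `R` and an `R`-module `M`, we construct the
cap product of an *absolute* cohomology class with a *relative* homology class,
`⌢ : Hᵖ(X; R) × Hₙ(X, A; M) → H_q(X, A; M)` (`p + q = n`), on the tree's relative singular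
homology `Literature.AlgebraicTopology.SingularHomology.relativeSingularHomology` (A. Hatcher, *Algebraic Topology* (2002), §3.3,
p. 240: "there is also a relative cap product `Hₖ(X, A; R) × Hˡ(X; R) → Hₖ₋ₗ(X, A; R)` …
the cap product `Cₖ(X; R) × Cˡ(X; R) → Cₖ₋ₗ(X; R)` restricts to `Cₖ(A; R) × Cˡ(X; R) → Cₖ₋ₗ(A; R)`
so there is an induced cap product on the quotient"), and prove the two identities that make it
usable for duality on manifolds with boundary (Hatcher 2002, §3.3, Thm. 3.43 and the
commutative diagram in its proof, p. 254):

* compatibility with the absolute cap product under `j_* : Hₙ(X) → Hₙ(X, A)`: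
  `a ⌢ j_* c = j_* (a ⌢ c)` (`relCapProduct_ofAbsolute`);
* the **boundary formula** `∂ (a ⌢ z) = (-1)ᵖ • (i^* a) ⌢ ∂ z` in `H_{q-1}(A; M)` for
  `a ∈ Hᵖ(X; R)`, `z ∈ Hₙ(X, A; M)`, `i : A → X` the inclusion (`δ_relCapProduct`), which is the
  chain-level boundary formula `∂(σ ⌢ φ) = (-1)ᵖ (∂σ ⌢ φ - σ ⌢ δφ)` (`Literature.AlgebraicTopology.SingularHomology.d_capChain`, Hatcher
  2002, p. 240) read for a cocycle `φ` and a relative cycle `σ`.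

## Method

The tree carries two models of the chains of a pair: Mathlib's
`relativeSingularChainComplex R M X A = cokernel (C(↥A) ⟶ C(X))` (`RelativeHomology.lean`, on
which `relativeSingularHomology`, `ofAbsolute`, `δ` are defined and used downstream), and the
concrete quotient `(chainsInSub R M X A).quotient` of the finitely-supported chain complex
`csingularChainComplex R M X` by the subcomplex of chains with image in `A` (`ChainSubcomplex.lean`,
`SingularChainsConcrete.lean`, `LocalHomology.lean`), which has an element-level API (`relCls`).
We first identify the two (`relativeSingularChainComplex.quotientIso`, built from
`csingularChainComplex.compIso` and `subspaceLift` by the universal property of the cokernel,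
together with the induced isomorphism of the two short exact sequences of the pair and hence the
compatibility with `π`/`ofAbsolute` and with the connecting maps `δ`), then do all chain-level
work concretely: the Alexander–Whitney cap `Literature.AlgebraicTopology.SingularHomology.capChain` transported to finitely supported
chains (`ccapChain`) preserves the chains of `A` (the back face of a simplex in `A` lies in `A`),
hence descends to relative cycles (`Subcomplex.relCls`), giving `crelCapProduct` on
`(chainsInSub R M X A).quotient.homology`; finally everything is transported back to
`relativeSingularHomology`. The connecting map is computed on relative classes by Mathlib's
`ShortComplex.ShortExact.δ_apply` (`Subcomplex.δ_relCls`).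

Everything here is definitions-with-bodies and proved lemmas; nothing is asserted (D-0014).
Mathlib (pinned) has no cap product and no relative singular homology (searched: `capProduct`,
`relativeSingular`, `cap product`); nothing here duplicates Mathlib.

## Main definitions

* `Literature.relativeSingularChainComplex.quotientIso R M X A :
    relativeSingularChainComplex R M X A ≅ (chainsInSub R M X A).quotient` and
  `Literature.relativeSingularHomology.concreteIso R M X A n` (on homology).
* `Literature.ccapChain M h φ`: the cap product with a cochain on concrete chains.
* `Literature.crelCapProduct h a`: cap with a cocycle on `(chainsInSub R M X A).quotient.homology`.
* `Literature.relCapProduct A h : Hᵖ(X; R) →ₗ[R] Hₙ(X, A; M) →ₗ[R] H_q(X, A; M)`.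

## Main statements (all proved)

* `Literature.AlgebraicTopology.SingularHomology.Subcomplex.δ_relCls`: `∂[x] = [d x]` for a relative cycle of a subcomplex pair.
* `Literature.AlgebraicTopology.SingularHomology.relativeSingularHomology.ofAbsolute_concreteIso`, `…δ_eq_concrete`: the identification
  of models is compatible with `j_*` and `∂`.
* `Literature.AlgebraicTopology.SingularHomology.relCapProduct_ofAbsolute`: `a ⌢ j_* c = j_* (a ⌢ c)`.
* `Literature.AlgebraicTopology.SingularHomology.δ_relCapProduct`: `∂ (a ⌢ z) = (-1)ᵖ • (i^* a) ⌢ ∂ z`.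

## References

* A. Hatcher, *Algebraic Topology*, CUP 2002, §2.1 (pp. 115–118, relative homology),
  §3.3 (pp. 239–241, cap product; p. 254, relative cap products and Lefschetz duality).
-/

noncomputable section

-- as in `SingularChainsConcrete`/`LocalHomology`: chains of the concrete complex are `Finsupp`s up
-- to unfolding of semireducible definitions (`ChainComplex.of`, `AlternatingFaceMapComplex`)
set_option backward.isDefEq.respectTransparency false

open CategoryTheory Limits AlgebraicTopology

universe u v w t

namespace Literature.AlgebraicTopology.SingularHomology

/-! ### Supplements on homology classes of complexes of modules -/

section Classes

variable {R : Type v} [CommRing R]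
variable {ι : Type t} {c : ComplexShape ι}
variable {K : HomologicalComplex (ModuleCat.{w} R) c} {i : ι}

/-- The element-level class `homologyCls z hz` (`ChainSubcomplex.lean`) is Mathlib's
`homologyπ` of the concrete cycle `cyclesMk z` (Hatcher 2002, §2.1, `[z] ∈ Ker ∂ / Im ∂`). [folklore] -/
lemma homologyCls_eq_homologyπ_cyclesMk (z : K.X i) (hz : K.d i (c.next i) z = 0) (j : ι)
    (hj : c.next i = j) (hz' : K.d i j z = 0) :
    homologyCls z hz = K.homologyπ i (K.cyclesMk z j hj hz') := by
  subst hj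
  unfold homologyCls scHomologyCls
  congr 1
  apply (ModuleCat.mono_iff_injective ((K.sc i).iCycles)).mp inferInstance
  rw [ShortComplex.moduleCatCyclesIso_inv_iCycles_apply]
  exact ((K.sc i).i_cyclesMk z hz).symm

namespace Subcomplex

variable (S : Subcomplex K)

/-- Relative classes are additive: `[x + y] = [x] + [y]` in `Hᵢ(K/S)` (Hatcher 2002, §2.1). [folklore] -/
lemma relCls_add {i : ι} (x y : K.X i) (hx : K.d i (c.next i) x ∈ S (c.next i))
    (hy : K.d i (c.next i) y ∈ S (c.next i)) (hxy : K.d i (c.next i) (x + y) ∈ S (c.next i)) :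
    S.relCls (x + y) hxy = S.relCls x hx + S.relCls y hy := by
  have h3 : S.quotient.d i (c.next i) (S.π.f i x + S.π.f i y) = 0 := by
    rw [map_add, S.d_π_f_eq_zero x hx, S.d_π_f_eq_zero y hy, add_zero]
  have e : S.π.f i (x + y) = S.π.f i x + S.π.f i y := map_add _ x y
  unfold relCls
  exact (homologyCls_congr e _ h3).trans
    (homologyCls_add (S.π.f i x) (S.π.f i y) (S.d_π_f_eq_zero x hx) (S.d_π_f_eq_zero y hy) h3)

/-- Relative classes are homogeneous: `[r • x] = r • [x]` in `Hᵢ(K/S)` (Hatcher 2002, §2.1). [folklore] -/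
lemma relCls_smul {i : ι} (r : R) (x : K.X i) (hx : K.d i (c.next i) x ∈ S (c.next i))
    (hrx : K.d i (c.next i) (r • x) ∈ S (c.next i)) :
    S.relCls (r • x) hrx = r • S.relCls x hx := by
  have h3 : S.quotient.d i (c.next i) (r • S.π.f i x) = 0 := by
    rw [map_smul, S.d_π_f_eq_zero x hx, smul_zero]
  have e : S.π.f i (r • x) = r • S.π.f i x := map_smul _ r x
  unfold relCls
  exact (homologyCls_congr e _ h3).trans (homologyCls_smul r (S.π.f i x) (S.d_π_f_eq_zero x hx) h3)

/-- A relative class is unchanged by adding a chain of the subcomplex: `[x + s] = [x]` for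
`s ∈ S` (Hatcher 2002, §2.1). [folklore] -/
lemma relCls_add_of_mem {i : ι} (x s : K.X i) (hx : K.d i (c.next i) x ∈ S (c.next i))
    (hs : s ∈ S i) (hxs : K.d i (c.next i) (x + s) ∈ S (c.next i)) :
    S.relCls (x + s) hxs = S.relCls x hx := by
  rw [relCls_eq_relCls_iff]
  exact ⟨0, by rw [map_zero, zero_sub, add_sub_cancel_left]; exact Submodule.neg_mem _ hs⟩

/-- A relative class is unchanged by adding a boundary: `[x + d w] = [x]` (Hatcher 2002, §2.1). [folklore] -/
lemma relCls_add_d {i : ι} (x : K.X i) (w : K.X (c.prev i)) (hx : K.d i (c.next i) x ∈ S (c.next i))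
    (hxw : K.d i (c.next i) (x + K.d (c.prev i) i w) ∈ S (c.next i)) :
    S.relCls (x + K.d (c.prev i) i w) hxw = S.relCls x hx := by
  rw [relCls_eq_relCls_iff]
  exact ⟨w, by rw [add_sub_cancel_left, sub_self]; exact Submodule.zero_mem _⟩


/-- Two relative cycles differing by a boundary `d w` (from any degree `i₀`) modulo `S` have the
same relative class (Hatcher 2002, §2.1). [folklore] -/
lemma relCls_eq_relCls_of_sub_mem {i i₀ : ι} (x y : K.X i) (hx : K.d i (c.next i) x ∈ S (c.next i))
    (hy : K.d i (c.next i) y ∈ S (c.next i)) (w : K.X i₀)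
    (hw : K.d i₀ i w - (x - y) ∈ S i) : S.relCls x hx = S.relCls y hy := by
  by_cases hr : c.Rel i₀ i
  · obtain rfl := c.prev_eq' hr
    exact (S.relCls_eq_relCls_iff x y hx hy).mpr ⟨w, hw⟩
  · rw [K.shape i₀ i hr] at hw
    refine (S.relCls_eq_relCls_iff x y hx hy).mpr ⟨0, ?_⟩
    rw [map_zero]
    exact hw

/-- **Descent of a chain operation to relative homology classes** (well-definedness).  Let
`f : Kᵢ → Kᵢ'` be `R`-linear, preserve the subcomplex (`f(Sᵢ) ⊆ Sᵢ'`) and send the boundary of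
any chain to a boundary modulo `S` (`∀ w, ∃ w', d w' - f (d w) ∈ S`).  Then `[x] = [y]` in
`Hᵢ(K/S)` implies `[f x] = [f y]` in `Hᵢ'(K/S)` (Hatcher 2002, §2.1 / §3.3 p. 240, the pattern
by which chain-level products "induce" products on relative classes). [folklore] -/
theorem relCls_map_congr {i i' : ι} (f : K.X i →ₗ[R] K.X i') (hmem : ∀ s ∈ S i, f s ∈ S i')
    (hex : ∀ (i₀ : ι) (w : K.X i₀), ∃ (i₀' : ι) (w' : K.X i₀'),
      K.d i₀' i' w' - f (K.d i₀ i w) ∈ S i')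
    {x y : K.X i} (hx : K.d i (c.next i) x ∈ S (c.next i)) (hy : K.d i (c.next i) y ∈ S (c.next i))
    (hfx : K.d i' (c.next i') (f x) ∈ S (c.next i')) (hfy : K.d i' (c.next i') (f y) ∈ S (c.next i'))
    (e : S.relCls x hx = S.relCls y hy) : S.relCls (f x) hfx = S.relCls (f y) hfy := by
  rw [relCls_eq_relCls_iff] at e
  obtain ⟨w, hw⟩ := e
  obtain ⟨i₀', w', hw'⟩ := hex _ w
  refine S.relCls_eq_relCls_of_sub_mem (f x) (f y) hfx hfy w' ?_
  have h2 : f (K.d (c.prev i) i w - (x - y)) ∈ S i' := hmem _ hw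
  have e : K.d i₀' i' w' - (f x - f y) =
      (K.d i₀' i' w' - f (K.d (c.prev i) i w)) + f (K.d (c.prev i) i w - (x - y)) := by
    rw [map_sub, map_sub]; abel
  rw [e]
  exact Submodule.add_mem _ hw' h2

/-- The function underlying `relClsMap`: on a relative class, pick a representing relative cycle
`x` and take `[f x]`. [folklore] -/
def relClsMapFun {i i' : ι} (f : K.X i →ₗ[R] K.X i')
    (hd : ∀ x, K.d i (c.next i) x ∈ S (c.next i) → K.d i' (c.next i') (f x) ∈ S (c.next i'))
    (α : S.quotient.homology i) : S.quotient.homology i' :=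
  S.relCls (f (S.relCls_surjective α).choose)
    (hd _ (S.relCls_surjective α).choose_spec.choose)

/-- `relClsMapFun f [x] = [f x]` (independence of the representative). [folklore] -/
lemma relClsMapFun_relCls {i i' : ι} (f : K.X i →ₗ[R] K.X i') (hmem : ∀ s ∈ S i, f s ∈ S i')
    (hd : ∀ x, K.d i (c.next i) x ∈ S (c.next i) → K.d i' (c.next i') (f x) ∈ S (c.next i'))
    (hex : ∀ (i₀ : ι) (w : K.X i₀), ∃ (i₀' : ι) (w' : K.X i₀'),
      K.d i₀' i' w' - f (K.d i₀ i w) ∈ S i')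
    (x : K.X i) (hx : K.d i (c.next i) x ∈ S (c.next i)) :
    S.relClsMapFun f hd (S.relCls x hx) = S.relCls (f x) (hd x hx) :=
  S.relCls_map_congr f hmem hex _ hx _ _ (S.relCls_surjective (S.relCls x hx)).choose_spec.choose_spec

/-- **The map on relative homology induced by a compatible chain operation.**  For an `R`-linear
`f : Kᵢ → Kᵢ'` preserving `S`, sending relative cycles to relative cycles and boundaries to
boundaries modulo `S`, the `R`-linear map `Hᵢ(K/S) → Hᵢ'(K/S)`, `[x] ↦ [f x]`
(Hatcher 2002, §3.3, p. 240: the induced relative cap product is the case `f = (· ⌢ φ)`). [folklore] -/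
def relClsMap {i i' : ι} (f : K.X i →ₗ[R] K.X i') (hmem : ∀ s ∈ S i, f s ∈ S i')
    (hd : ∀ x, K.d i (c.next i) x ∈ S (c.next i) → K.d i' (c.next i') (f x) ∈ S (c.next i'))
    (hex : ∀ (i₀ : ι) (w : K.X i₀), ∃ (i₀' : ι) (w' : K.X i₀'),
      K.d i₀' i' w' - f (K.d i₀ i w) ∈ S i') :
    S.quotient.homology i →ₗ[R] S.quotient.homology i' where
  toFun := S.relClsMapFun f hd
  map_add' α β := by
    obtain ⟨x, hx, rfl⟩ := S.relCls_surjective α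
    obtain ⟨y, hy, rfl⟩ := S.relCls_surjective β
    have hxy : K.d i (c.next i) (x + y) ∈ S (c.next i) := by
      rw [map_add]; exact Submodule.add_mem _ hx hy
    rw [← S.relCls_add x y hx hy hxy, S.relClsMapFun_relCls f hmem hd hex,
      S.relClsMapFun_relCls f hmem hd hex, S.relClsMapFun_relCls f hmem hd hex,
      ← S.relCls_add (f x) (f y) (hd x hx) (hd y hy)
        (by rw [map_add]; exact Submodule.add_mem _ (hd x hx) (hd y hy))]
    congr 1
    exact map_add f x y
  map_smul' r α := by
    obtain ⟨x, hx, rfl⟩ := S.relCls_surjective α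
    have hrx : K.d i (c.next i) (r • x) ∈ S (c.next i) := by
      rw [map_smul]; exact Submodule.smul_mem _ r hx
    rw [RingHom.id_apply, ← S.relCls_smul r x hx hrx, S.relClsMapFun_relCls f hmem hd hex,
      S.relClsMapFun_relCls f hmem hd hex,
      ← S.relCls_smul r (f x) (hd x hx)
        (by rw [map_smul]; exact Submodule.smul_mem _ r (hd x hx))]
    congr 1
    exact map_smul f r x

/-- `relClsMap f [x] = [f x]` (Hatcher 2002, §3.3, p. 240). [folklore] -/
@[simp]
lemma relClsMap_relCls {i i' : ι} (f : K.X i →ₗ[R] K.X i') (hmem : ∀ s ∈ S i, f s ∈ S i')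
    (hd : ∀ x, K.d i (c.next i) x ∈ S (c.next i) → K.d i' (c.next i') (f x) ∈ S (c.next i'))
    (hex : ∀ (i₀ : ι) (w : K.X i₀), ∃ (i₀' : ι) (w' : K.X i₀'),
      K.d i₀' i' w' - f (K.d i₀ i w) ∈ S i')
    (x : K.X i) (hx : K.d i (c.next i) x ∈ S (c.next i)) :
    S.relClsMap f hmem hd hex (S.relCls x hx) = S.relCls (f x) (hd x hx) :=
  S.relClsMapFun_relCls f hmem hd hex x hx


/-- The relative class only depends on the chain. [folklore] -/
lemma relCls_congr {i : ι} {x y : K.X i} (e : x = y) (hx : K.d i (c.next i) x ∈ S (c.next i))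
    (hy : K.d i (c.next i) y ∈ S (c.next i)) : S.relCls x hx = S.relCls y hy := by
  subst e
  rfl

/-- `[0] = 0` in `Hᵢ(K/S)`. [folklore] -/
@[simp]
lemma relCls_zero {i : ι} (h0 : K.d i (c.next i) 0 ∈ S (c.next i)) : S.relCls (0 : K.X i) h0 = 0 := by
  unfold relCls
  exact (homologyCls_congr (map_zero _) _ (by rw [map_zero])).trans (homologyCls_zero _)

/-- **The connecting map on a relative class.** For the short exact sequence
`0 → S → K → K/S → 0` of a subcomplex and a relative cycle `x ∈ Kᵢ` with `d x ∈ Sⱼ`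
(`c.Rel i j`), `∂ [x] = [d x]` in `Hⱼ(S)` (Hatcher 2002, §2.1, Thm. 2.16: "`∂[c] = [∂c]`").
From Mathlib's `ShortComplex.ShortExact.δ_apply`. [cite: Hatcher2002, §2.1 Thm. 2.16] -/
theorem δ_relCls (i j : ι) (hij : c.Rel i j) (x : K.X i) (hx : K.d i j x ∈ S j) :
    S.shortExact.δ i j hij (S.relCls x (by rw [c.next_eq' hij]; exact hx)) =
      homologyCls (K := S.toComplex) (⟨K.d i j x, hx⟩ : S.toComplex.X j)
        (by
          apply S.ι_f_injective
          rw [map_zero]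
          change K.d j (c.next j) (K.d i j x) = 0
          rw [← ModuleCat.comp_apply, K.d_comp_d]; rfl) := by
  have h := S.shortExact.δ_apply i j hij (S.π.f i x)
    (by
      change S.quotient.d i j (S.π.f i x) = 0
      rw [S.quotient_d_π_f]; exact (S.π_f_eq_zero_iff j _).mpr hx)
    x rfl (⟨K.d i j x, hx⟩ : S.toComplex.X j) rfl (c.next j) rfl
  rw [Subcomplex.relCls, homologyCls_eq_homologyπ_cyclesMk _ _ j (c.next_eq' hij),
    homologyCls_eq_homologyπ_cyclesMk _ _ (c.next j) rfl]
  exact h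

end Subcomplex

end Classes

/-! ### The two models of the chains of a pair agree -/

section Comparison

variable (R : Type v) [CommRing R] (M : Type v) [AddCommGroup M] [Module R M]
variable {X : Type u} [TopologicalSpace X]

namespace relativeSingularChainComplex

/-- `subsetι ≫ compIso⁻¹ ≫ π = 0`: chains of `↥A`, pushed into Mathlib's chains of `X`, transported
to concrete chains and projected to `C(X)/C(A)`, vanish (they land in `chainsIn A`)
(Hatcher 2002, §2.1). [folklore] -/
lemma subsetι_comp_compIso_inv_comp_π (A : Set X) :
    singularChainComplex.subsetι R M X A ≫ (csingularChainComplex.compIso R M X).inv ≫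
      (chainsInSub R M X A).π = 0 := by
  have e : singularChainComplex.subsetι R M X A ≫ (csingularChainComplex.compIso R M X).inv =
      (csingularChainComplex.compIso R M A).inv ≫ subspaceLift R M X A ≫ (chainsInSub R M X A).ι := by
    rw [subspaceLift_ι, Iso.eq_inv_comp, ← Category.assoc,
      ← csingularChainComplex.map_comp_compIso_hom, Category.assoc, Iso.hom_inv_id, Category.comp_id]
  rw [← Category.assoc, e, Category.assoc, Category.assoc, Subcomplex.ι_π, comp_zero, comp_zero]

variable (X) in
/-- The comparison chain map `C(X, A) = coker (C(↥A) → C(X)) ⟶ C(X)/C(A)` to the concrete quotient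
complex, induced by `compIso⁻¹ ≫ π` (Hatcher 2002, §2.1: both are "the" quotient `Cₙ(X)/Cₙ(A)`). [folklore] -/
def toQuotient (A : Set X) :
    relativeSingularChainComplex R M X A ⟶ (chainsInSub R M X A).quotient :=
  cokernel.desc _ ((csingularChainComplex.compIso R M X).inv ≫ (chainsInSub R M X A).π)
    (subsetι_comp_compIso_inv_comp_π R M A)

/-- `π ≫ toQuotient = compIso⁻¹ ≫ π'`. [folklore] -/
@[reassoc (attr := simp)]
lemma π_comp_toQuotient (A : Set X) :
    π R M X A ≫ toQuotient R M X A =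
      (csingularChainComplex.compIso R M X).inv ≫ (chainsInSub R M X A).π :=
  cokernel.π_desc _ _ _

/-- `ι ≫ compIso ≫ π = 0`: concrete chains in `A`, transported to Mathlib's chains, die in
`C(X, A)`. [folklore] -/
lemma ι_comp_compIso_hom_comp_π (A : Set X) :
    (chainsInSub R M X A).ι ≫ (csingularChainComplex.compIso R M X).hom ≫ π R M X A = 0 := by
  have e : (chainsInSub R M X A).ι ≫ (csingularChainComplex.compIso R M X).hom =
      inv (subspaceLift R M X A) ≫ (csingularChainComplex.compIso R M A).hom ≫
        singularChainComplex.subsetι R M X A := by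
    rw [IsIso.eq_inv_comp, ← Category.assoc, subspaceLift_ι,
      csingularChainComplex.map_comp_compIso_hom]
  rw [← Category.assoc, e, Category.assoc, Category.assoc, subsetι_comp_π, comp_zero, comp_zero]

variable (X) in
/-- The inverse comparison chain map `C(X)/C(A) ⟶ C(X, A)`, induced by `compIso ≫ π` through the
universal property of the quotient (`Subcomplex.shortExact`, `gIsCokernel`). [folklore] -/
def ofQuotient (A : Set X) :
    (chainsInSub R M X A).quotient ⟶ relativeSingularChainComplex R M X A :=
  (chainsInSub R M X A).shortExact.gIsCokernel.desc
    (CokernelCofork.ofπ ((csingularChainComplex.compIso R M X).hom ≫ π R M X A)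
      (ι_comp_compIso_hom_comp_π R M A))

/-- `π' ≫ ofQuotient = compIso ≫ π`. [folklore] -/
@[reassoc (attr := simp)]
lemma π_comp_ofQuotient (A : Set X) :
    (chainsInSub R M X A).π ≫ ofQuotient R M X A =
      (csingularChainComplex.compIso R M X).hom ≫ π R M X A :=
  Cofork.IsColimit.π_desc (chainsInSub R M X A).shortExact.gIsCokernel

variable (X) in
/-- **`C(X, A) ≅ C(X)/C(A)`**: Mathlib's relative singular chain complex (a cokernel in the
category of chain complexes) is isomorphic to the concrete quotient complex of finitely supported
chains modulo chains in `A` (Hatcher 2002, §2.1, `Cₙ(X, A) = Cₙ(X)/Cₙ(A)`). [folklore] -/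
def quotientIso (A : Set X) :
    relativeSingularChainComplex R M X A ≅ (chainsInSub R M X A).quotient where
  hom := toQuotient R M X A
  inv := ofQuotient R M X A
  hom_inv_id := by
    haveI := epi_π R M (X := X) A
    rw [← cancel_epi (π R M X A), π_comp_toQuotient_assoc, π_comp_ofQuotient, Iso.inv_hom_id_assoc,
      Category.comp_id]
  inv_hom_id := by
    rw [← cancel_epi (chainsInSub R M X A).π, π_comp_ofQuotient_assoc, π_comp_toQuotient,
      Iso.hom_inv_id_assoc, Category.comp_id]

/-- The isomorphism of short exact sequences of complexes
`(C(↥A) → C(X) → C(X, A)) ≅ (C(A) → C(X) → C(X)/C(A))` (Mathlib's model to the concrete one),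
with components `compIso⁻¹ ≫ subspaceLift`, `compIso⁻¹`, `quotientIso.hom`
(Hatcher 2002, §2.1, naturality of the long exact sequence). [folklore] -/
def comparisonMap (A : Set X) :
    ShortComplex.mk (singularChainComplex.subsetι R M X A) (π R M X A) (cokernel.condition _) ⟶
      (chainsInSub R M X A).shortComplex :=
  ShortComplex.homMk
    ((csingularChainComplex.compIso R M A).inv ≫ subspaceLift R M X A)
    (csingularChainComplex.compIso R M X).inv (quotientIso R M X A).hom
    (by
      change ((csingularChainComplex.compIso R M A).inv ≫ subspaceLift R M X A) ≫
          (chainsInSub R M X A).ι = singularChainComplex.subsetι R M X A ≫ _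
      rw [Category.assoc, subspaceLift_ι, Iso.inv_comp_eq, ← Category.assoc,
        ← csingularChainComplex.map_comp_compIso_hom, Category.assoc, Iso.hom_inv_id,
        Category.comp_id])
    (by
      change (csingularChainComplex.compIso R M X).inv ≫ (chainsInSub R M X A).π =
        π R M X A ≫ toQuotient R M X A
      rw [π_comp_toQuotient])

end relativeSingularChainComplex

namespace relativeSingularHomology

variable (X) in
/-- **`Hₙ(X, A; M)` in the two models agree**: the isomorphism
`relativeSingularHomology R M X A n ≅ Hₙ(C(X)/C(A))` induced by
`relativeSingularChainComplex.quotientIso` (Hatcher 2002, §2.1). [folklore] -/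
def concreteIso (A : Set X) (n : ℕ) :
    relativeSingularHomology R M X A n ≅ (chainsInSub R M X A).quotient.homology n :=
  (HomologicalComplex.homologyFunctor _ _ n).mapIso (relativeSingularChainComplex.quotientIso R M X A)

/-- `concreteIso.hom = H(toQuotient)`. [folklore] -/
lemma concreteIso_hom (A : Set X) (n : ℕ) :
    (concreteIso R M X A n).hom =
      HomologicalComplex.homologyMap (relativeSingularChainComplex.toQuotient R M X A) n := rfl

/-- `concreteIso.inv = H(ofQuotient)`. [folklore] -/
lemma concreteIso_inv (A : Set X) (n : ℕ) :
    (concreteIso R M X A n).inv =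
      HomologicalComplex.homologyMap (relativeSingularChainComplex.ofQuotient R M X A) n := rfl

/-- Compatibility with `j_*`: `j_* ≫ concreteIso = H(compIso)⁻¹ ≫ H(π')`, i.e. the class of an
absolute cycle goes to its relative class in the concrete model (Hatcher 2002, §2.1). [folklore] -/
@[reassoc]
lemma ofAbsolute_comp_concreteIso_hom (A : Set X) (n : ℕ) :
    ofAbsolute R M X A n ≫ (concreteIso R M X A n).hom =
      (csingularHomology.compIso R M X n).inv ≫
        HomologicalComplex.homologyMap (chainsInSub R M X A).π n := by
  rw [ofAbsolute, concreteIso_hom, ← HomologicalComplex.homologyMap_comp,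
    relativeSingularChainComplex.π_comp_toQuotient, HomologicalComplex.homologyMap_comp]
  rfl

/-- Compatibility with the connecting maps: under the identifications of the two models,
Mathlib's `∂ : Hₙ₊₁(X, A) → Hₙ(↥A)` is the concrete `∂ : Hₙ₊₁(C(X)/C(A)) → Hₙ(C(A))` followed by
`Hₙ(C(A)) ≅ Hₙ(↥A)` (Hatcher 2002, §2.1, naturality of `∂`, Thm. 2.16 ff.). [folklore] -/
@[reassoc]
lemma δ_comp (A : Set X) (n : ℕ) :
    δ R M X A n ≫ (csingularHomology.compIso R M A n).inv ≫
        HomologicalComplex.homologyMap (subspaceLift R M X A) n =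
      (concreteIso R M X A (n + 1)).hom ≫ (chainsInSub R M X A).shortExact.δ (n + 1) n rfl := by
  have h := HomologicalComplex.HomologySequence.δ_naturality
    (relativeSingularChainComplex.comparisonMap R M A)
    (relativeSingularChainComplex.shortExact_subsetι_π R M X A) (chainsInSub R M X A).shortExact
    (n + 1) n rfl
  rw [δ, concreteIso_hom]
  refine Eq.trans ?_ h
  change _ = _ ≫ HomologicalComplex.homologyMap ((csingularChainComplex.compIso R M A).inv ≫
    subspaceLift R M X A) n
  rw [HomologicalComplex.homologyMap_comp]
  rfl

/-- The connecting map of Mathlib's model expressed through the concrete one: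
`∂ = concreteIso ≫ ∂' ≫ H(subspaceLift)⁻¹ ≫ H(compIso)` (Hatcher 2002, §2.1). [folklore] -/
lemma δ_eq_concrete (A : Set X) (n : ℕ) :
    δ R M X A n = (concreteIso R M X A (n + 1)).hom ≫ (chainsInSub R M X A).shortExact.δ (n + 1) n rfl ≫
      (homologySubIso R M X A n).hom ≫ (csingularHomology.compIso R M A n).hom := by
  rw [← δ_comp_assoc, homologySubIso]
  change δ R M X A n = δ R M X A n ≫ (csingularHomology.compIso R M (↥A) n).inv ≫
    ((HomologicalComplex.homologyFunctor _ _ n).mapIso (subspaceIso R M X A)).hom ≫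
      ((HomologicalComplex.homologyFunctor _ _ n).mapIso (subspaceIso R M X A)).inv ≫
        (csingularHomology.compIso R M (↥A) n).hom
  rw [Iso.hom_inv_id_assoc, Iso.inv_hom_id, Category.comp_id]

end relativeSingularHomology

end Comparison

/-! ### The cap product on concrete chains -/

section CCap

variable {R : Type v} [CommRing R] {M : Type v} [AddCommGroup M] [Module R M]
variable {X Y : Type u} [TopologicalSpace X] [TopologicalSpace Y]
variable {p q n : ℕ}

/-- The image of a back face is contained in the image of the simplex (Hatcher 2002, §3.3,
`σ|[vₚ,…,vₙ]`). [folklore] -/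
lemma SingularSimplex.range_backFace_subset (h : q ≤ n) (σ : SingularSimplex X n) :
    (σ.backFace h).range ⊆ σ.range := by
  rintro _ ⟨t, rfl⟩
  exact ⟨_, rfl⟩

/-- The image of a front face is contained in the image of the simplex (Hatcher 2002, §3.3,
`σ|[v₀,…,vₚ]`). [folklore] -/
lemma SingularSimplex.range_frontFace_subset (h : p ≤ n) (σ : SingularSimplex X n) :
    (σ.frontFace h).range ⊆ σ.range := by
  rintro _ ⟨t, rfl⟩
  exact ⟨_, rfl⟩

/-- The inverse comparison isomorphism on an elementary chain: `m • σ ↦ single σ m`. [folklore] -/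
lemma csingularChainComplex.compIso_inv_f_single (σ : SingularSimplex X n) (m : M) :
    (csingularChainComplex.compIso R M X).inv.f n (singularChainComplex.single (R := R) σ m) =
      Finsupp.single σ m := by
  rw [← csingularChainComplex.compIso_hom_f_single, ← ModuleCat.comp_apply,
    ← HomologicalComplex.comp_f, Iso.hom_inv_id]
  rfl

variable (M) in
/-- The Alexander–Whitney cap product with a cochain `φ ∈ Cᵖ(X; R)` on *concrete* (finitely
supported) chains, `Cₙ(X; M) ⟶ C_q(X; M)` for `p + q = n`,
`single σ m ↦ single σ|[vₚ,…,vₙ] (φ(σ|[v₀,…,vₚ]) • m)` (Hatcher 2002, §3.3, p. 239):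
`Literature.AlgebraicTopology.SingularHomology.capChain` conjugated by the comparison isomorphism `csingularChainComplex.compIso`. [cite: Hatcher2002, §3.3 p. 239] -/
def ccapChain (h : p + q = n) (φ : SingularSimplex X p → R) :
    (csingularChainComplex R M X).X n ⟶ (csingularChainComplex R M X).X q :=
  (csingularChainComplex.compIso R M X).hom.f n ≫ capChain M h φ ≫
    (csingularChainComplex.compIso R M X).inv.f q

/-- `ccapChain` is `capChain` under the comparison isomorphism: `ccap ≫ comp = comp ≫ cap`. [folklore] -/
@[reassoc]
lemma ccapChain_comp_compIso_hom (h : p + q = n) (φ : SingularSimplex X p → R) :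
    ccapChain M h φ ≫ (csingularChainComplex.compIso R M X).hom.f q =
      (csingularChainComplex.compIso R M X).hom.f n ≫ capChain M h φ := by
  rw [ccapChain, Category.assoc, Category.assoc, ← HomologicalComplex.comp_f, Iso.inv_hom_id,
    HomologicalComplex.id_f, Category.comp_id]

/-- `comp⁻¹ ≫ ccap = cap ≫ comp⁻¹`. [folklore] -/
@[reassoc]
lemma compIso_inv_comp_ccapChain (h : p + q = n) (φ : SingularSimplex X p → R) :
    (csingularChainComplex.compIso R M X).inv.f n ≫ ccapChain M h φ =
      capChain M h φ ≫ (csingularChainComplex.compIso R M X).inv.f q := by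
  rw [ccapChain, ← Category.assoc, ← HomologicalComplex.comp_f, Iso.inv_hom_id,
    HomologicalComplex.id_f, Category.id_comp]

/-- The concrete cap product on an elementary chain:
`single σ m ⌢ φ = single σ|[vₚ,…,vₙ] (φ(σ|[v₀,…,vₚ]) • m)` (Hatcher 2002, §3.3, p. 239). [cite: Hatcher2002, §3.3 p. 239] -/
@[simp]
lemma ccapChain_single (h : p + q = n) (φ : SingularSimplex X p → R) (σ : SingularSimplex X n)
    (m : M) :
    ccapChain M h φ (Finsupp.single σ m) =
      Finsupp.single (σ.backFace (show q ≤ n by omega)) (φ (σ.frontFace (show p ≤ n by omega)) • m) := by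
  rw [ccapChain, ModuleCat.comp_apply, ModuleCat.comp_apply,
    csingularChainComplex.compIso_hom_f_single, capChain_single,
    csingularChainComplex.compIso_inv_f_single]

/-- The concrete cap product is `R`-linear in the cochain (Hatcher 2002, §3.3, bilinearity). [folklore] -/
lemma ccapChain_add (h : p + q = n) (φ ψ : SingularSimplex X p → R) :
    ccapChain M h (φ + ψ) = ccapChain M h φ + ccapChain M h ψ := by
  rw [ccapChain, ccapChain, ccapChain, capChain_add, Preadditive.add_comp, Preadditive.comp_add]

/-- The concrete cap product is homogeneous in the cochain (Hatcher 2002, §3.3, bilinearity). [folklore] -/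
lemma ccapChain_smul (h : p + q = n) (r : R) (φ : SingularSimplex X p → R) :
    ccapChain M h (r • φ) = r • ccapChain M h φ := by
  rw [ccapChain, ccapChain, capChain_smul, Linear.smul_comp, Linear.comp_smul]

/-- Capping with the zero cochain is zero. [folklore] -/
@[simp]
lemma ccapChain_zero (h : p + q = n) : ccapChain M h (0 : SingularSimplex X p → R) = 0 := by
  rw [ccapChain, capChain_zero, zero_comp, comp_zero]

/-- **Locality of the cap product**: capping a chain with image in `A` gives a chain with image in
`A` (the back face of a simplex in `A` lies in `A`), i.e. `Cₙ(A) ⌢ Cᵖ(X) ⊆ C_q(A)`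
(Hatcher 2002, §3.3, p. 240: "the cap product restricts to `Cₖ(A; R) × Cˡ(X; R) → Cₖ₋ₗ(A; R)`"). [cite: Hatcher2002, §3.3 p. 240] -/
theorem ccapChain_mem_chainsIn (h : p + q = n) (φ : SingularSimplex X p → R) {A : Set X}
    {c : CChain M X n} (hc : c ∈ chainsIn R M X A n) :
    ccapChain M h φ c ∈ chainsIn R M X A q := by
  rw [← Finsupp.sum_single c, Finsupp.sum, map_sum]
  refine Submodule.sum_mem _ fun σ hσ => ?_
  rw [ccapChain_single]
  exact single_mem_chainsIn R M
    ((SingularSimplex.range_backFace_subset _ σ).trans ((mem_chainsIn_iff R M c).mp hc σ hσ)) _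

/-- The projection formula on concrete chains: `f♯(c) ⌢ φ = f♯(c ⌢ f^♯φ)`
(Hatcher 2002, §3.3, p. 241, naturality of the cap product). [cite: Hatcher2002, §3.3 p. 241] -/
lemma ccapChain_map (f : C(X, Y)) (h : p + q = n) (φ : SingularSimplex Y p → R) :
    (csingularChainComplex.map R M f).f n ≫ ccapChain M h φ =
      ccapChain M h ((singularCochainComplex.map R R f).f p φ) ≫
        (csingularChainComplex.map R M f).f q := by
  apply ModuleCat.hom_ext
  refine Finsupp.lhom_ext fun σ m => ?_
  change ccapChain M h φ ((csingularChainComplex.map R M f).f n (Finsupp.single σ m)) =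
    (csingularChainComplex.map R M f).f q (ccapChain M h _ (Finsupp.single σ m))
  rw [csingularChainComplex.map_f_single, ccapChain_single, ccapChain_single,
    csingularChainComplex.map_f_single, SingularSimplex.frontFace_map, SingularSimplex.backFace_map,
    singularCochainComplex.map_apply]

/-- **The boundary formula on concrete chains**,
`∂(σ ⌢ φ) = (-1)ᵖ (∂σ ⌢ φ - σ ⌢ δφ)` for `σ ∈ Cₙ₊₁(X; M)`, `φ ∈ Cᵖ(X; R)`, `p + q = n`
(Hatcher 2002, §3.3, p. 240), transported from `Literature.AlgebraicTopology.SingularHomology.d_capChain`. [cite: Hatcher2002, §3.3 p. 240] -/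
theorem d_ccapChain (h : p + q = n) (φ : SingularSimplex X p → R) :
    ccapChain M (show p + (q + 1) = n + 1 by omega) φ ≫ (csingularChainComplex R M X).d (q + 1) q =
      (-1 : R) ^ p • ((csingularChainComplex R M X).d (n + 1) n ≫ ccapChain M h φ -
        ccapChain M (show (p + 1) + q = n + 1 by omega)
          ((singularCochainComplex R R X).d p (p + 1) φ)) := by
  have hd := d_capChain (M := M) (X := X) h φ
  rw [ccapChain, ccapChain, ccapChain, Category.assoc, Category.assoc,
    (csingularChainComplex.compIso R M X).inv.comm, reassoc_of% hd, Linear.smul_comp,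
    Linear.comp_smul, Preadditive.sub_comp, Preadditive.comp_sub, Category.assoc,
    ← (csingularChainComplex.compIso R M X).hom.comm_assoc]

end CCap

/-! ### The relative cap product in the concrete model -/

section CRelCap

variable {R : Type v} [CommRing R] {M : Type v} [AddCommGroup M] [Module R M]
variable {X : Type u} [TopologicalSpace X]
variable {p q n : ℕ}

open singularCochainComplex

/-- The boundary formula on concrete chains, applied to a chain:
`∂(x ⌢ φ) = (-1)ᵖ (∂x ⌢ φ - x ⌢ δφ)` (Hatcher 2002, §3.3, p. 240). [cite: Hatcher2002, §3.3 p. 240] -/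
lemma d_ccapChain_apply (h : p + q = n) (φ : SingularSimplex X p → R)
    (x : (csingularChainComplex R M X).X (n + 1)) :
    (csingularChainComplex R M X).d (q + 1) q
        (ccapChain M (show p + (q + 1) = n + 1 by omega) φ x) =
      (-1 : R) ^ p • (ccapChain M h φ ((csingularChainComplex R M X).d (n + 1) n x) -
        ccapChain M (show (p + 1) + q = n + 1 by omega)
          ((singularCochainComplex R R X).d p (p + 1) φ) x) := by
  have e := congr($(d_ccapChain (M := M) (X := X) h φ) x)
  simpa only [ModuleCat.hom_comp, ModuleCat.hom_smul, ModuleCat.hom_sub, LinearMap.comp_apply,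
    LinearMap.smul_apply, LinearMap.sub_apply] using e

/-- For a cocycle `a`, `∂(x ⌢ a) = (-1)ᵖ ∂x ⌢ a` on concrete chains (Hatcher 2002, §3.3,
p. 240). [cite: Hatcher2002, §3.3 p. 240] -/
lemma d_ccapChain_iCocycles_apply (h : p + q = n) (a : cocycles R R X p)
    (x : (csingularChainComplex R M X).X (n + 1)) :
    (csingularChainComplex R M X).d (q + 1) q
        (ccapChain M (show p + (q + 1) = n + 1 by omega) (iCocycles R R X p a) x) =
      (-1 : R) ^ p • ccapChain M h (iCocycles R R X p a)
        ((csingularChainComplex R M X).d (n + 1) n x) := by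
  rw [d_ccapChain_apply h, d_iCocycles, ccapChain_zero]
  simp

variable (A : Set X)

/-- Capping with a cochain preserves the subcomplex of chains in `A` (Hatcher 2002, §3.3,
p. 240). [cite: Hatcher2002, §3.3 p. 240] -/
lemma ccapChain_mem_chainsInSub (h : p + q = n) (φ : SingularSimplex X p → R)
    (s : (csingularChainComplex R M X).X n) (hs : s ∈ chainsInSub R M X A n) :
    (ccapChain M h φ).hom s ∈ chainsInSub R M X A q :=
  ccapChain_mem_chainsIn h φ hs

/-- Capping with a cocycle sends relative cycles to relative cycles: if `∂x ∈ C(A)` then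
`∂(x ⌢ a) = ±∂x ⌢ a ∈ C(A)` (Hatcher 2002, §3.3, p. 240). [cite: Hatcher2002, §3.3 p. 240] -/
lemma d_ccapChain_mem_chainsInSub (h : p + q = n) (a : cocycles R R X p)
    (x : (csingularChainComplex R M X).X n)
    (hx : (csingularChainComplex R M X).d n ((ComplexShape.down ℕ).next n) x ∈
      chainsInSub R M X A ((ComplexShape.down ℕ).next n)) :
    (csingularChainComplex R M X).d q ((ComplexShape.down ℕ).next q)
        ((ccapChain M h (iCocycles R R X p a)).hom x) ∈
      chainsInSub R M X A ((ComplexShape.down ℕ).next q) := by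
  cases q with
  | zero =>
    rw [(csingularChainComplex R M X).shape 0 _ (by simp)]
    exact Submodule.zero_mem _
  | succ q' =>
    obtain rfl : n = (p + q') + 1 := by omega
    rw [ChainComplex.next_nat_succ] at hx ⊢
    change (csingularChainComplex R M X).d (q' + 1) q' (ccapChain M h _ x) ∈ _
    rw [d_ccapChain_iCocycles_apply (rfl : p + q' = p + q')]
    exact Submodule.smul_mem _ _ (ccapChain_mem_chainsIn _ _ hx)

/-- Capping with a cocycle sends boundaries to boundaries: `∂w ⌢ a = ±∂(w ⌢ a)`
(Hatcher 2002, §3.3, p. 240). [cite: Hatcher2002, §3.3 p. 240] -/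
lemma exists_d_sub_ccapChain_d_mem (h : p + q = n) (a : cocycles R R X p) (i₀ : ℕ)
    (w : (csingularChainComplex R M X).X i₀) :
    ∃ (i₀' : ℕ) (w' : (csingularChainComplex R M X).X i₀'),
      (csingularChainComplex R M X).d i₀' q w' -
          (ccapChain M h (iCocycles R R X p a)).hom ((csingularChainComplex R M X).d i₀ n w) ∈
        chainsInSub R M X A q := by
  by_cases hi : i₀ = n + 1
  · subst hi
    refine ⟨q + 1, (-1 : R) ^ p • ccapChain M (show p + (q + 1) = n + 1 by omega)
      (iCocycles R R X p a) w, ?_⟩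
    rw [map_smul, d_ccapChain_iCocycles_apply h, smul_smul, ← mul_pow, neg_one_mul, neg_neg, one_pow,
      one_smul]
    change _ - ccapChain M h _ _ ∈ _
    rw [sub_self]
    exact Submodule.zero_mem _
  · refine ⟨0, 0, ?_⟩
    have e : (csingularChainComplex R M X).d i₀ n w = 0 := by
      rw [(csingularChainComplex R M X).shape i₀ n (fun h' => hi (by simp at h'; omega))]
      rfl
    rw [e, map_zero, map_zero, sub_zero]
    exact Submodule.zero_mem _

/-- **The relative cap product with a cocycle in the concrete model**,
`Hₙ(C(X)/C(A)) → H_q(C(X)/C(A))`, `[x] ↦ [x ⌢ a]` for a relative cycle `x`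
(Hatcher 2002, §3.3, p. 240, "induced cap product on the quotient"). [cite: Hatcher2002, §3.3 p. 240] -/
def crelCapProduct (h : p + q = n) (a : cocycles R R X p) :
    (chainsInSub R M X A).quotient.homology n →ₗ[R] (chainsInSub R M X A).quotient.homology q :=
  (chainsInSub R M X A).relClsMap (ccapChain M h (iCocycles R R X p a)).hom
    (ccapChain_mem_chainsInSub A h _) (d_ccapChain_mem_chainsInSub A h a)
    (exists_d_sub_ccapChain_d_mem A h a)

/-- `crelCapProduct A h a [x] = [x ⌢ a]` for a relative cycle `x` (Hatcher 2002, §3.3, p. 240). [cite: Hatcher2002, §3.3 p. 240] -/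
@[simp]
lemma crelCapProduct_relCls (h : p + q = n) (a : cocycles R R X p)
    (x : (csingularChainComplex R M X).X n)
    (hx : (csingularChainComplex R M X).d n ((ComplexShape.down ℕ).next n) x ∈
      chainsInSub R M X A ((ComplexShape.down ℕ).next n)) :
    crelCapProduct A h a ((chainsInSub R M X A).relCls x hx) =
      (chainsInSub R M X A).relCls (ccapChain M h (iCocycles R R X p a) x)
        (d_ccapChain_mem_chainsInSub A h a x hx) :=
  (chainsInSub R M X A).relClsMap_relCls _ _ _ _ x hx

/-- The concrete relative cap product is additive in the cocycle (Hatcher 2002, §3.3, bilinearity). [folklore] -/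
lemma crelCapProduct_add (h : p + q = n) (a b : cocycles R R X p) :
    crelCapProduct (M := M) A h (a + b) = crelCapProduct A h a + crelCapProduct A h b := by
  ext α
  obtain ⟨x, hx, rfl⟩ := (chainsInSub R M X A).relCls_surjective α
  rw [LinearMap.add_apply, crelCapProduct_relCls, crelCapProduct_relCls, crelCapProduct_relCls]
  have e : (ccapChain M h (iCocycles R R X p (a + b))).hom x =
      (ccapChain M h (iCocycles R R X p a)).hom x + (ccapChain M h (iCocycles R R X p b)).hom x := by
    rw [map_add, ccapChain_add]
    rfl
  rw [(chainsInSub R M X A).relCls_congr e _ (by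
    rw [map_add]
    exact Submodule.add_mem _ (d_ccapChain_mem_chainsInSub A h a x hx)
      (d_ccapChain_mem_chainsInSub A h b x hx))]
  exact (chainsInSub R M X A).relCls_add _ _ _ _ _

/-- The concrete relative cap product is homogeneous in the cocycle (Hatcher 2002, §3.3, bilinearity). [folklore] -/
lemma crelCapProduct_smul (h : p + q = n) (r : R) (a : cocycles R R X p) :
    crelCapProduct (M := M) A h (r • a) = r • crelCapProduct A h a := by
  ext α
  obtain ⟨x, hx, rfl⟩ := (chainsInSub R M X A).relCls_surjective α
  rw [LinearMap.smul_apply, crelCapProduct_relCls, crelCapProduct_relCls]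
  have e : (ccapChain M h (iCocycles R R X p (r • a))).hom x =
      r • (ccapChain M h (iCocycles R R X p a)).hom x := by
    rw [map_smul, ccapChain_smul]
    rfl
  rw [(chainsInSub R M X A).relCls_congr e _ (by
    rw [map_smul]
    exact Submodule.smul_mem _ r (d_ccapChain_mem_chainsInSub A h a x hx))]
  exact (chainsInSub R M X A).relCls_smul _ _ _ _

/-- Capping a relative cycle with a coboundary gives a boundary modulo `C(A)`:
`x ⌢ δψ = ∂x ⌢ ψ ± ∂(x ⌢ ψ)` with `∂x ⌢ ψ ∈ C(A)`, so `crelCapProduct` kills coboundaries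
(Hatcher 2002, §3.3, p. 240). Stated for `toCocycles i p` with arbitrary source index `i`. [cite: Hatcher2002, §3.3 p. 240] -/
lemma crelCapProduct_toCocycles (h : p + q = n) (i : ℕ) (ψ : (singularCochainComplex R R X).X i) :
    crelCapProduct (M := M) A h (toCocycles R R X i p ψ) = 0 := by
  by_cases hi : i + 1 = p
  · subst hi
    obtain rfl : n = (i + q) + 1 := by omega
    ext α
    obtain ⟨x, hx, rfl⟩ := (chainsInSub R M X A).relCls_surjective α
    rw [crelCapProduct_relCls, LinearMap.zero_apply,
      ← (chainsInSub R M X A).relCls_zero (by rw [map_zero]; exact Submodule.zero_mem _)]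
    refine (chainsInSub R M X A).relCls_eq_relCls_of_sub_mem _ _ _ _
      (-(-1 : R) ^ i • ccapChain M (show i + (q + 1) = i + q + 1 by omega) ψ x) ?_
    have hsq : -(-1 : R) ^ i * (-1) ^ i = -1 := by
      rw [neg_mul, ← mul_pow, neg_one_mul, neg_neg, one_pow]
    rw [sub_zero, map_smul, d_ccapChain_apply (rfl : i + q = i + q), smul_smul, hsq, neg_one_smul,
      neg_sub, iCocycles_toCocycles]
    change _ - ccapChain M h _ x ∈ _
    rw [sub_sub_cancel_left]
    refine Submodule.neg_mem _ (ccapChain_mem_chainsIn _ _ ?_)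
    rw [ChainComplex.next_nat_succ] at hx
    exact hx
  · have e : toCocycles R R X i p ψ = 0 := cocycles_ext (by
      rw [iCocycles_toCocycles, (singularCochainComplex R R X).shape i p hi, map_zero]
      rfl)
    rw [e, ← zero_smul R (0 : cocycles R R X p), crelCapProduct_smul, zero_smul]

/-- `a ↦ crelCapProduct A h a` as an `R`-linear map on cocycles (Hatcher 2002, §3.3, p. 240). [folklore] -/
def crelCapProductCocycles (h : p + q = n) :
    cocycles R R X p →ₗ[R]
      ((chainsInSub R M X A).quotient.homology n →ₗ[R] (chainsInSub R M X A).quotient.homology q) where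
  toFun a := crelCapProduct A h a
  map_add' a b := crelCapProduct_add A h a b
  map_smul' r a := crelCapProduct_smul A h r a

/-- `crelCapProductCocycles A h a = crelCapProduct A h a`. [folklore] -/
@[simp]
lemma crelCapProductCocycles_apply (h : p + q = n) (a : cocycles R R X p) :
    crelCapProductCocycles (M := M) A h a = crelCapProduct A h a := rfl

/-- Descent to cohomology classes: the morphism `Hᵖ(X; R) ⟶ Hom_R(Hₙ(C(X)/C(A)), H_q(C(X)/C(A)))`,
`[a] ↦ ([x] ↦ [x ⌢ a])`, from the universal property of `Hᵖ = coker (Cᵖ⁻¹ → Zᵖ)`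
(Hatcher 2002, §3.3, p. 240). [cite: Hatcher2002, §3.3 p. 240] -/
def crelCapProductHom (h : p + q = n) :
    singularCohomology R R X p ⟶ ModuleCat.of R
      ((chainsInSub R M X A).quotient.homology n →ₗ[R] (chainsInSub R M X A).quotient.homology q) :=
  Cofork.IsColimit.desc
    ((singularCochainComplex R R X).homologyIsCokernel ((ComplexShape.up ℕ).prev p) p rfl)
    (ModuleCat.ofHom (crelCapProductCocycles A h)) (by
      rw [zero_comp]
      ext ψ : 2
      exact crelCapProduct_toCocycles A h _ ψ)

/-- `crelCapProductHom A h [a] = crelCapProduct A h a` (Hatcher 2002, §3.3, p. 240). [cite: Hatcher2002, §3.3 p. 240] -/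
@[simp]
lemma crelCapProductHom_π (h : p + q = n) (a : cocycles R R X p) :
    crelCapProductHom (M := M) A h (singularCohomology.π R R X p a) = crelCapProduct A h a := by
  have e := Cofork.IsColimit.π_desc'
    ((singularCochainComplex R R X).homologyIsCokernel ((ComplexShape.up ℕ).prev p) p rfl)
    (ModuleCat.ofHom (crelCapProductCocycles (M := M) A h))
  exact congr($(e (by
      rw [zero_comp]
      ext ψ : 2
      exact crelCapProduct_toCocycles A h _ ψ)) a)

end CRelCap

/-! ### The relative cap product on `relativeSingularHomology` and its two identities -/

section RelCap

variable {R : Type v} [CommRing R] {M : Type v} [AddCommGroup M] [Module R M]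
variable {X : Type u} [TopologicalSpace X]
variable {p q n : ℕ}

open singularCochainComplex

/-- The comparison `Hₙ(C(X)) ≅ Hₙ(X)` on an element-level class: `[y] ↦ [comp y]`. [folklore] -/
lemma csingularHomology.compIso_hom_homologyCls (y : (csingularChainComplex R M X).X n)
    (hy : (csingularChainComplex R M X).d n ((ComplexShape.down ℕ).next n) y = 0) :
    (csingularHomology.compIso R M X n).hom (homologyCls y hy) =
      homologyCls ((csingularChainComplex.compIso R M X).hom.f n y)
        (d_hom_f_eq_zero (csingularChainComplex.compIso R M X).hom y hy) :=
  homologyMap_homologyCls _ y hy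

/-- The inverse comparison `Hₙ(X) ≅ Hₙ(C(X))` on an element-level class: `[z] ↦ [comp⁻¹ z]`. [folklore] -/
lemma csingularHomology.compIso_inv_homologyCls (z : (singularChainComplex R M X).X n)
    (hz : (singularChainComplex R M X).d n ((ComplexShape.down ℕ).next n) z = 0) :
    (csingularHomology.compIso R M X n).inv (homologyCls z hz) =
      homologyCls ((csingularChainComplex.compIso R M X).inv.f n z)
        (d_hom_f_eq_zero (csingularChainComplex.compIso R M X).inv z hz) :=
  homologyMap_homologyCls _ z hz

/-- For a cocycle `a` and a cycle `z`, `z ⌢ a` is a cycle (Hatcher 2002, §3.3, p. 240), element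
form of `Literature.AlgebraicTopology.SingularHomology.iCycles_capChain_d`. [cite: Hatcher2002, §3.3 p. 240] -/
lemma d_capChain_iCocycles_eq_zero (h : p + q = n) (a : cocycles R R X p)
    (z : (singularChainComplex R M X).X n)
    (hz : (singularChainComplex R M X).d n ((ComplexShape.down ℕ).next n) z = 0) (j : ℕ) :
    (singularChainComplex R M X).d q j (capChain M h (iCocycles R R X p a) z) = 0 := by
  have h1 : singularChainComplex.iCycles R M X n ((singularChainComplex R M X).cyclesMk z _ rfl hz) = z :=
    (singularChainComplex R M X).i_cyclesMk z _ rfl hz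
  have e := congr($(iCycles_capChain_d (M := M) h a j)
    ((singularChainComplex R M X).cyclesMk z _ rfl hz))
  rw [ModuleCat.comp_apply, ModuleCat.comp_apply, h1] at e
  exact e

/-- **The absolute cap product on element-level classes**: `[a] ⌢ [z] = [z ⌢ a]` for a cocycle
`a` and a cycle `z ∈ Cₙ(X; M)` given as a chain with `∂z = 0` (Hatcher 2002, §3.3, p. 240;
`Literature.AlgebraicTopology.SingularHomology.capProduct_π_homologyπ` rewritten with `homologyCls`). [cite: Hatcher2002, §3.3 p. 240] -/
lemma capProduct_π_homologyCls (h : p + q = n) (a : cocycles R R X p)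
    (z : (singularChainComplex R M X).X n)
    (hz : (singularChainComplex R M X).d n ((ComplexShape.down ℕ).next n) z = 0) :
    capProduct h (singularCohomology.π R R X p a) (homologyCls z hz) =
      homologyCls (capChain M h (iCocycles R R X p a) z)
        (d_capChain_iCocycles_eq_zero h a z hz _) := by
  rw [homologyCls_eq_homologyπ_cyclesMk z hz _ rfl hz, capProduct_π_homologyπ,
    homologyCls_eq_homologyπ_cyclesMk _ _ _ rfl (d_capChain_iCocycles_eq_zero h a z hz _)]
  congr 1
  refine singularChainComplex.cycles_ext ?_
  rw [iCycles_capCycles]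
  have h1 : singularChainComplex.iCycles R M X n ((singularChainComplex R M X).cyclesMk z _ rfl hz) = z :=
    (singularChainComplex R M X).i_cyclesMk z _ rfl hz
  have h2 : singularChainComplex.iCycles R M X q ((singularChainComplex R M X).cyclesMk
      (capChain M h (iCocycles R R X p a) z) _ rfl (d_capChain_iCocycles_eq_zero h a z hz _)) =
        capChain M h (iCocycles R R X p a) z :=
    (singularChainComplex R M X).i_cyclesMk _ _ rfl _
  rw [h1, h2]

variable (A : Set X)

/-- **The relative cap product** `⌢ : Hᵖ(X; R) × Hₙ(X, A; M) → H_q(X, A; M)`, `p + q = n`, of an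
absolute cohomology class with a relative homology class, as an `R`-bilinear map on the tree's
`relativeSingularHomology` (Hatcher 2002, §3.3, p. 240: "a relative cap product
`Hₖ(X, A; R) × Hˡ(X; R) → Hₖ₋ₗ(X, A; R)`", induced from `Cₖ(X; R) × Cˡ(X; R) → Cₖ₋ₗ(X; R)` on the
quotient by `Cₖ(A; R)`): the concrete `crelCapProductHom` conjugated by the model isomorphisms
`relativeSingularHomology.concreteIso`. On representatives, `[a] ⌢ [x] = [x ⌢ a]`. [cite: Hatcher2002, §3.3 p. 240] -/
def relCapProduct (h : p + q = n) :
    singularCohomology R R X p →ₗ[R]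
      relativeSingularHomology R M X A n →ₗ[R] relativeSingularHomology R M X A q :=
  ((crelCapProductHom (M := M) A h).hom.compl₂
      (relativeSingularHomology.concreteIso R M X A n).hom.hom).compr₂
    (relativeSingularHomology.concreteIso R M X A q).inv.hom

/-- Unfolding `relCapProduct` through the concrete model. [folklore] -/
lemma relCapProduct_apply (h : p + q = n) (a : singularCohomology R R X p)
    (z : relativeSingularHomology R M X A n) :
    relCapProduct A h a z = (relativeSingularHomology.concreteIso R M X A q).inv
      (crelCapProductHom (M := M) A h a ((relativeSingularHomology.concreteIso R M X A n).hom z)) :=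
  rfl

/-- The relative cap product on representatives: for a cocycle `a` and a relative cycle `x` of the
concrete model, `[a] ⌢ [x] = [x ⌢ a]` (Hatcher 2002, §3.3, p. 240). [cite: Hatcher2002, §3.3 p. 240] -/
lemma relCapProduct_π_concreteIso_inv_relCls (h : p + q = n) (a : cocycles R R X p)
    (x : (csingularChainComplex R M X).X n)
    (hx : (csingularChainComplex R M X).d n ((ComplexShape.down ℕ).next n) x ∈
      chainsInSub R M X A ((ComplexShape.down ℕ).next n)) :
    relCapProduct A h (singularCohomology.π R R X p a)
        ((relativeSingularHomology.concreteIso R M X A n).inv ((chainsInSub R M X A).relCls x hx)) =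
      (relativeSingularHomology.concreteIso R M X A q).inv
        ((chainsInSub R M X A).relCls (ccapChain M h (iCocycles R R X p a) x)
          (d_ccapChain_mem_chainsInSub A h a x hx)) := by
  rw [relCapProduct_apply, Iso.inv_hom_id_apply, crelCapProductHom_π, crelCapProduct_relCls]

/-- The model isomorphism on the image of an absolute class: `concreteIso (j_* [z]) = [comp⁻¹ z]`
as a relative class. [folklore] -/
lemma concreteIso_hom_ofAbsolute_homologyCls (z : (singularChainComplex R M X).X n)
    (hz : (singularChainComplex R M X).d n ((ComplexShape.down ℕ).next n) z = 0) :
    (relativeSingularHomology.concreteIso R M X A n).hom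
        (relativeSingularHomology.ofAbsolute R M X A n (homologyCls z hz)) =
      (chainsInSub R M X A).relCls ((csingularChainComplex.compIso R M X).inv.f n z)
        (by rw [d_hom_f_eq_zero _ z hz]; exact Submodule.zero_mem _) := by
  rw [← ModuleCat.comp_apply, relativeSingularHomology.ofAbsolute_comp_concreteIso_hom,
    ModuleCat.comp_apply, csingularHomology.compIso_inv_homologyCls,
    Subcomplex.homologyMap_π_homologyCls]

/-- **Compatibility with the absolute cap product**: for `a ∈ Hᵖ(X; R)` and `c ∈ Hₙ(X; M)`,
`a ⌢ j_* c = j_* (a ⌢ c)` in `H_q(X, A; M)`, where `j_* : H(X) → H(X, A)`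
(Hatcher 2002, §3.3, p. 240–241, naturality of the cap product / the relative cap product is
induced by the absolute one on chains). [cite: Hatcher2002, §3.3 pp. 240–241] -/
theorem relCapProduct_ofAbsolute (h : p + q = n) (a : singularCohomology R R X p)
    (c : singularHomology R M X n) :
    relCapProduct A h a (relativeSingularHomology.ofAbsolute R M X A n c) =
      relativeSingularHomology.ofAbsolute R M X A q (capProduct h a c) := by
  induction a using singularCohomology_induction_on with
  | h a =>
  obtain ⟨z, hz, rfl⟩ := homologyCls_surjective c
  apply (ModuleCat.mono_iff_injective (relativeSingularHomology.concreteIso R M X A q).hom).mp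
    inferInstance
  have e1 : relativeSingularHomology.ofAbsolute R M X A n (homologyCls z hz) =
      (relativeSingularHomology.concreteIso R M X A n).inv
        ((chainsInSub R M X A).relCls ((csingularChainComplex.compIso R M X).inv.f n z)
          (by rw [d_hom_f_eq_zero _ z hz]; exact Submodule.zero_mem _)) := by
    rw [← concreteIso_hom_ofAbsolute_homologyCls, Iso.hom_inv_id_apply]
  rw [e1, relCapProduct_π_concreteIso_inv_relCls, Iso.inv_hom_id_apply, capProduct_π_homologyCls,
    concreteIso_hom_ofAbsolute_homologyCls]
  refine (chainsInSub R M X A).relCls_congr ?_ _ _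
  change ((csingularChainComplex.compIso R M X).inv.f n ≫ ccapChain M h _) z =
    (capChain M h _ ≫ (csingularChainComplex.compIso R M X).inv.f q) z
  rw [compIso_inv_comp_ccapChain]

/-- A chain of the subspace whose push-forward is the boundary of a relative cycle is a cycle. [folklore] -/
lemma d_eq_zero_of_map_val_eq_d {i : ℕ} (x : (csingularChainComplex R M X).X (i + 1))
    (y : (csingularChainComplex R M A).X i)
    (hy : (csingularChainComplex.map R M (⟨Subtype.val, continuous_subtype_val⟩ : C(A, X))).f i y =
      (csingularChainComplex R M X).d (i + 1) i x) :
    (csingularChainComplex R M A).d i ((ComplexShape.down ℕ).next i) y = 0 := by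
  have hinj : Function.Injective ((csingularChainComplex.map R M
      (⟨Subtype.val, continuous_subtype_val⟩ : C(A, X))).f ((ComplexShape.down ℕ).next i)) := by
    intro u v huv
    rw [csingularChainComplex.map_f_apply, csingularChainComplex.map_f_apply] at huv
    exact mapDomain_val_injective (M := M) A _ huv
  apply hinj
  rw [map_zero, ← ModuleCat.comp_apply, ← HomologicalComplex.Hom.comm, ModuleCat.comp_apply, hy,
    ← ModuleCat.comp_apply, HomologicalComplex.d_comp_d]
  rfl

/-- **The connecting map on a relative class, in Mathlib's model**: if `x` is a relative cycle of
the concrete model with `∂x = y` pushed forward from a chain `y` of `↥A`, then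
`∂ (concreteIso⁻¹ [x]) = [comp y]` in `Hᵢ(↥A; M)` (Hatcher 2002, §2.1, Thm. 2.16: `∂[x] = [∂x]`). [cite: Hatcher2002, §2.1 Thm. 2.16] -/
theorem δ_concreteIso_inv_relCls {i : ℕ} (x : (csingularChainComplex R M X).X (i + 1))
    (hx : (csingularChainComplex R M X).d (i + 1) ((ComplexShape.down ℕ).next (i + 1)) x ∈
      chainsInSub R M X A ((ComplexShape.down ℕ).next (i + 1)))
    (y : (csingularChainComplex R M A).X i)
    (hy : (csingularChainComplex.map R M (⟨Subtype.val, continuous_subtype_val⟩ : C(A, X))).f i y =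
      (csingularChainComplex R M X).d (i + 1) i x) :
    relativeSingularHomology.δ R M X A i
        ((relativeSingularHomology.concreteIso R M X A (i + 1)).inv ((chainsInSub R M X A).relCls x hx)) =
      homologyCls ((csingularChainComplex.compIso R M A).hom.f i y)
        (d_hom_f_eq_zero _ y (d_eq_zero_of_map_val_eq_d A x y hy)) := by
  have hx' : (csingularChainComplex R M X).d (i + 1) i x ∈ chainsInSub R M X A i := by
    rw [ChainComplex.next_nat_succ] at hx
    exact hx
  rw [relativeSingularHomology.δ_eq_concrete, ModuleCat.comp_apply, ModuleCat.comp_apply,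
    ModuleCat.comp_apply, Iso.inv_hom_id_apply]
  erw [(chainsInSub R M X A).δ_relCls (i + 1) i rfl x hx']
  have e : (⟨(csingularChainComplex R M X).d (i + 1) i x, hx'⟩ : (chainsInSub R M X A).toComplex.X i) =
      (subspaceLift R M X A).f i y := Subtype.ext hy.symm
  rw [homologyCls_congr e _ (d_hom_f_eq_zero _ y (d_eq_zero_of_map_val_eq_d A x y hy)),
    ← homologyMap_homologyCls (subspaceLift R M X A) y (d_eq_zero_of_map_val_eq_d A x y hy),
    ← csingularHomology.compIso_hom_homologyCls, homologySubIso]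
  change ((HomologicalComplex.homologyMap (subspaceIso R M X A).hom i ≫
    HomologicalComplex.homologyMap (subspaceIso R M X A).inv i) ≫ _) _ = _
  rw [← HomologicalComplex.homologyMap_comp, Iso.hom_inv_id, HomologicalComplex.homologyMap_id,
    Category.id_comp]

/-- **The boundary formula for the relative cap product.**  For `a ∈ Hᵖ(X; R)` and
`z ∈ Hₙ₊₁(X, A; M)` (`p + q = n`),
`∂ (a ⌢ z) = (-1)ᵖ • (i^* a) ⌢ (∂ z)` in `H_q(A; M)`,
where `∂` are the connecting homomorphisms of the pair, `i : A → X` is the inclusion and the cap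
product on the right is the absolute one of `↥A` (Hatcher 2002, §3.3, p. 240, the boundary formula
`∂(σ ⌢ φ) = (-1)ᵖ(∂σ ⌢ φ - σ ⌢ δφ)` on relative cycles; this is the commutativity, up to the sign
`(-1)ᵖ`, of the square in the proof of Thm. 3.43, p. 254). [cite: Hatcher2002, §3.3 p. 240 and p. 254] -/
theorem δ_relCapProduct (h : p + q = n) (a : singularCohomology R R X p)
    (z : relativeSingularHomology R M X A (n + 1)) :
    relativeSingularHomology.δ R M X A q (relCapProduct A (show p + (q + 1) = n + 1 by omega) a z) =
      (-1 : R) ^ p • capProduct h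
        (singularCohomology.map R R (⟨Subtype.val, continuous_subtype_val⟩ : C(A, X)) p a)
        (relativeSingularHomology.δ R M X A n z) := by
  induction a using singularCohomology_induction_on with
  | h a =>
  obtain ⟨z', rfl⟩ := (ModuleCat.epi_iff_surjective
    (relativeSingularHomology.concreteIso R M X A (n + 1)).inv).mp inferInstance z
  obtain ⟨x, hx, rfl⟩ := (chainsInSub R M X A).relCls_surjective z'
  -- a chain `y` of `↥A` pushing forward to `∂x`
  have hx' : (csingularChainComplex R M X).d (n + 1) n x ∈ chainsIn R M X A n := by
    rw [ChainComplex.next_nat_succ] at hx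
    exact hx
  rw [← range_lmapDomain_val] at hx'
  obtain ⟨y, hy⟩ := hx'
  have hy' : (csingularChainComplex.map R M (⟨Subtype.val, continuous_subtype_val⟩ : C(A, X))).f n y =
      (csingularChainComplex R M X).d (n + 1) n x := hy
  -- the chain `(-1)ᵖ • y ⌢ i^♯a` of `↥A` pushes forward to `∂(x ⌢ a)`
  set ψ : SingularSimplex A p → R :=
    (singularCochainComplex.map R R (⟨Subtype.val, continuous_subtype_val⟩ : C(A, X))).f p
      (iCocycles R R X p a) with hψ
  have hy'' : (csingularChainComplex.map R M (⟨Subtype.val, continuous_subtype_val⟩ : C(A, X))).f q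
      ((-1 : R) ^ p • ccapChain M h ψ y) =
        (csingularChainComplex R M X).d (q + 1) q
          (ccapChain M (show p + (q + 1) = n + 1 by omega) (iCocycles R R X p a) x) := by
    rw [map_smul, d_ccapChain_iCocycles_apply h, ← hy']
    change (-1 : R) ^ p • (ccapChain M h ψ ≫ (csingularChainComplex.map R M _).f q) y =
      (-1 : R) ^ p • ((csingularChainComplex.map R M _).f n ≫ ccapChain M h (iCocycles R R X p a)) y
    rw [ccapChain_map]
  rw [relCapProduct_π_concreteIso_inv_relCls, δ_concreteIso_inv_relCls A _ _ _ hy'',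
    δ_concreteIso_inv_relCls A x hx y hy', singularCohomology.map_π, capProduct_π_homologyCls,
    ← homologyCls_smul ((-1 : R) ^ p) _ _ (by
      have h0 := d_capChain_iCocycles_eq_zero h
        (cocyclesMap R R (⟨Subtype.val, continuous_subtype_val⟩ : C(A, X)) p a)
        ((csingularChainComplex.compIso R M A).hom.f n y)
        (d_hom_f_eq_zero (csingularChainComplex.compIso R M A).hom y
          (d_eq_zero_of_map_val_eq_d A x y hy'))
        ((ComplexShape.down ℕ).next q)
      rw [map_smul, h0, smul_zero])]
  refine homologyCls_congr ?_ _ _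
  rw [map_smul, iCocycles_cocyclesMap]
  congr 1
  change ((ccapChain M h ψ ≫ (csingularChainComplex.compIso R M A).hom.f q) y) =
    ((csingularChainComplex.compIso R M A).hom.f n ≫ capChain M h ψ) y
  rw [ccapChain_comp_compIso_hom]

end RelCap

end Literature.AlgebraicTopology.SingularHomology

end
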